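import Literature.NumberTheory.GaloisRepresentations.PresentationCocycleTransport
import Literature.NumberTheory.GaloisRepresentations.IdeleLocalInvariantReadout
import Literature.NumberTheory.GaloisRepresentations.IdeleLocalInvariantReadoutArch
import Literature.NumberTheory.GaloisRepresentations.IdeleProjection
import Literature.NumberTheory.GaloisRepresentations.IdeleBarHomOfLocalHoms
import Literature.NumberTheory.GaloisRepresentations.HomDualUnramifiedSplitting
import Literature.NumberTheory.GaloisRepresentations.DecompositionGroupOfCompletion
import Literature.NumberTheory.GaloisRepresentations.ContinuousH1ResCocycle
import Literature.NumberTheory.EllipticCurves.PeriodIndexSupport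
import HarnessLib

/-!
# The transport at the PLACES: the finite dictionary `localInv E v [b] = inv_{K_v}((π_v ∘ f)_* res_v δ₁^K x)` (P3), the
# archimedean transport `[pull_{archReadoutPair} b] = (π_w ∘ f)_* res_w δ₁^K x` (P4), and the inflated class `x` is
# unramified wherever the inertia groups lie in `U_E` (P0) (Milne *ADT* I Thm. 4.10, proof; Neukirch II (9.6))

Topic `NumberTheory/GaloisRepresentations`; namespace `Literature.NumberTheory.GaloisRepresentations.FreePresentation`.
Theorems only (no definition, no named fact, no instance, no notation, no `sorry`); one LOCAL instance attribute
(`absoluteGaloisGroup_compactSpace`, the tree's theorem).  Sequel to `PresentationCocycleTransport` (door-c4 g18: the transport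
identity `twoCocycleClass_pull_eq_of_H2π_eq` for an abstract compatible pair at any place), instantiated at
* a FINITE place `v` with door-c5's `IdeleCohomology.readoutPair v (layerEmb E)` (`readoutPair_f/φ`, `galRestrict_layerEmb`,
  `ideleProjection_inr_of`) and composed with door-c5's F7-dict (ii) `localInv_eq_readout` — **`localInv_H2π_eq_brauerInvariantEquiv`**
  = item (P3) of the idèle package of `SchneiderFreeAdditiveX3PoitouTateReciprocityGeneralBase`;
* an INFINITE place `w` with door-c4 g18's `IdeleCohomology.archReadoutPair w (layerEmb E)` (`archReadoutPair_f/φ`,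
  `galRestrictField_layerEmb`, `ideleProjection_inl_of`) — **`twoCocycleClass_archReadoutPair_pull_eq`** (equality; item (P4) asks only
  for the `= 0 ↔ = 0` consequence, at the real places);
and the ramification of the inflated class:
* **`localization_inflatedClass_mem_unramifiedSubgroup`** — `loc_v x ∈ H¹_ur(K_v, M)` at every finite `v` all of whose inertia groups
  lie in `U_E` (the cocycle `σ ↦ γ(σ̄)` restricted to `Γ_{K_v^{nr}}` is identically `0`: `Γ_{K_v^{nr}} → I_{K_v}` (`absGaloisRestrict_mem_galUnr`),
  `res(I_{K_v}) = I_{𝔓_v} ≤ U_E` (`inertia_adicCompletionPrime_eq_map_absInertia`), `γ(1) = 0`); with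
  `EllipticCurves.eventually_forall_inertia_le U_E` this is item (P0) off a finite set (`exists_finset_forall_localization_inflatedClass_mem`).

HONEST FRAMING: bookkeeping; no case of Poitou–Tate or BSD is proved.  Route A (R4) transport of crux `AnticycControlAdditiveK`
(item 19295, cell bsd-schneider), seat door-c4 gen 18.

## References
* J. S. Milne, *Arithmetic Duality Theorems* (2nd ed. 2006), I §4, proof of Theorem 4.10 (p. 58), Lemma 4.13. [MilneADT2006]
* J. Neukirch, *Algebraic Number Theory* (1999), Ch. II §9 Prop. (9.6), Ch. III Thm. (2.6). [NeukirchANT1999]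
* J.-P. Serre, *Local Fields*, GTM 67 (1979), IV §4; *Galois Cohomology* (1997), I §2.2–2.4. [SerreLocalFields1979]
  [SerreGaloisCohomology1997]
-/

noncomputable section

open NumberField IsDedekindDomain CategoryTheory CategoryTheory.Abelian groupCohomology Function
open Field (absoluteGaloisGroup)
open Literature.Algebra.Homology Literature.Algebra.Homology.DiscreteRep
open Literature.NumberTheory.Automorphic
open scoped Classical

namespace Literature.NumberTheory.GaloisRepresentations

open IdeleClassBar DGMBridge HomDual DiscreteGaloisModule IdeleReadout
open Literature.AnabelianGeometry.AbsoluteAnabelian.Prop121vii (brauerInvariantEquiv)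

namespace FreePresentation

-- continuous cocycle classes on `Γ_{K_v}` need `LocallyCompactSpace`; the tree's theorem, local, no override.
attribute [local instance] absoluteGaloisGroup_compactSpace

variable {K : Type} [Field K] [NumberField K]
variable {M : Type} [AddCommGroup M] [TopologicalSpace M] [DiscreteTopology M] [Finite M] (ρ : DiscreteGaloisModule K M)
variable {E : GalLayer K} (h : presentationLayer ρ ≤ E)

/-! ## §1 Finite places: door-c5's readout pair and the finite dictionary (P3) -/

section Finite

variable (v : HeightOneSpectrum (𝓞 K))

omit [NumberField K] in
/-- The group component of `readoutPair v (layerEmb E)` is `s ↦ (res s)|_E`. [cite: SerreGaloisCohomology1997, I §2.4] -/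
theorem readoutPair_f_layerEmb [NumberField K] (s : absoluteGaloisGroup (v.adicCompletion K)) :
    (haveI := E.numberField; haveI := E.isGalois; (IdeleCohomology.readoutPair v (layerEmb E)).f s) =
      E.restrictHom (absGaloisRestrict K (v.adicCompletion K) s) := by
  haveI := E.numberField
  haveI := E.isGalois
  rw [IdeleCohomology.readoutPair_f]
  exact galRestrict_layerEmb E v s

/-- The module component of `readoutPair v (layerEmb E)` is `π_v ∘ [·]_E` for THE idèle projection `π_v = ideleProjection K (inr v)`.
[cite: MilneADT2006, I Lemma 4.13 (proof)] -/
theorem readoutPair_φ_layerEmb (x : (ideleData K).V E) :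
    (haveI := E.numberField; haveI := E.isGalois; (IdeleCohomology.readoutPair v (layerEmb E)).φ x) =
      (ideleProjection K (Sum.inr v)).toAddMonoidHom ((ideleData K).toSystem.of E x) := by
  haveI := E.numberField
  haveI := E.isGalois
  rw [IdeleCohomology.readoutPair_φ]
  exact (ideleProjection_inr_of v E x).symm

include h

/-- **(P3) THE FINITE DICTIONARY: `localInv E v [b] = inv_{K_v}((π_v ∘ f)_* res_v (δ₁^K x))`** for every cocycle `b` representing
`iso^J_E ((f^{U_E})_* δ[γ])` and `x = inflatedClass γ` (door-c5's F7-dict (ii) `localInv_eq_readout` + the transport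
`twoCocycleClass_pull_eq_of_H2π_eq` at the finite place `v`). [cite: MilneADT2006, I §4, proof of Theorem 4.10 (p. 58)]
[cite: CasselsFrohlichANT1967, Ch. VII §7.3 Cor. 7.4 (b), §11.2] -/
theorem localInv_H2π_eq_brauerInvariantEquiv
    (γ : cocycles₁ ((invariantsQuotFunctor ℤ (E.openNormalSubgroup : Subgroup (absoluteGaloisGroup K))).obj
      (presentationComplex ρ).X₃)) (f : (presentationComplex ρ).X₁ ⟶ ideleBarD K)
    (b : cocycles₂ ((ideleData K).obj E))
    (hb : (H2π _) b = ((ideleData K).layerCohomologyIso E 2).hom ((groupCohomology.map (MonoidHom.id _)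
        ((invariantsQuotFunctor ℤ (E.openNormalSubgroup : Subgroup (absoluteGaloisGroup K))).map f) 2).hom
        ((groupCohomology.δ (presentationComplex_map_invariantsQuotFunctor_shortExact ρ h) 1 2 rfl).hom ((H1π _) γ)))) :
    (haveI := E.numberField; haveI := E.isGalois; IdeleCohomology.localInv E.1 v ((H2π (IdeleClassGroup.ideleRep K E.1)) b)) =
      (haveI := moduleFinite_presModule₁ ρ
       haveI : CharZero (v.adicCompletion K) := charZero_of_algebra (K := K) (v.adicCompletion K)
       brauerInvariantEquiv (v.adicCompletion K)
        (cohomologyMap (toTopRepHom ((presModule₁ ρ).restrictField (v.adicCompletion K)) (units (v.adicCompletion K))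
            (equivariantMap ((presModule₁ ρ).restrictField (v.adicCompletion K)) (units (v.adicCompletion K))
              (readoutInvariant (ideleProjection K (Sum.inr v)) (presentationComplex ρ).X₁ f))) 2
          (galoisCohomology.res (presModule₁ ρ) (v.adicCompletion K) 2 ((pres_isSES ρ).δ₁ (inflatedClass ρ h γ))))) := by
  haveI := E.numberField
  haveI := E.isGalois
  haveI := moduleFinite_presModule₁ ρ
  haveI : CharZero (v.adicCompletion K) := charZero_of_algebra (K := K) (v.adicCompletion K)
  rw [IdeleCohomology.localInv_eq_readout v (layerEmb E) b]
  exact congrArg (brauerInvariantEquiv (v.adicCompletion K))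
    (twoCocycleClass_pull_eq_of_H2π_eq ρ h (Sum.inr v) (ideleProjection K (Sum.inr v))
      (IdeleCohomology.readoutPair v (layerEmb E)) (readoutPair_f_layerEmb v) (readoutPair_φ_layerEmb v) γ f b hb)

end Finite

/-! ## §2 Infinite places: the archimedean readout pair and the archimedean transport (P4) -/

section Infinite

variable (w : InfinitePlace K)

omit [NumberField K] in
/-- The group component of `archReadoutPair w (layerEmb E)` is `s ↦ (res s)|_E`. [cite: SerreGaloisCohomology1997, I §2.4] -/
theorem archReadoutPair_f_layerEmb [NumberField K] (s : absoluteGaloisGroup w.Completion) :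
    (haveI := E.numberField; haveI := E.isGalois; (IdeleCohomology.archReadoutPair w (layerEmb E)).f s) =
      E.restrictHom (absGaloisRestrict K w.Completion s) := by
  haveI := E.numberField
  haveI := E.isGalois
  rw [IdeleCohomology.archReadoutPair_f]
  exact galRestrictField_layerEmb E w.Completion s

/-- The module component of `archReadoutPair w (layerEmb E)` is `π_w ∘ [·]_E` for THE idèle projection `π_w = ideleProjection K (inl w)`.
[cite: MilneADT2006, I Lemma 4.13 (proof)] -/
theorem archReadoutPair_φ_layerEmb (x : (ideleData K).V E) :
    (haveI := E.numberField; haveI := E.isGalois; (IdeleCohomology.archReadoutPair w (layerEmb E)).φ x) =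
      (ideleProjection K (Sum.inl w)).toAddMonoidHom ((ideleData K).toSystem.of E x) := by
  haveI := E.numberField
  haveI := E.isGalois
  rw [IdeleCohomology.archReadoutPair_φ]
  exact (ideleProjection_inl_of w E x).symm

include h

/-- **(P4) THE ARCHIMEDEAN TRANSPORT (equality form): `[pull_{archReadoutPair w} b] = (π_w ∘ f)_* res_w (δ₁^K x)`** in
`H²(Γ_{K_w}, K̄_wˣ)` for every cocycle `b` representing `iso^J_E ((f^{U_E})_* δ[γ])` and `x = inflatedClass γ`.
[cite: MilneADT2006, I §4, proof of Theorem 4.10 (p. 58), Ex. 1.6 (c)] -/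
theorem twoCocycleClass_archReadoutPair_pull_eq
    (γ : cocycles₁ ((invariantsQuotFunctor ℤ (E.openNormalSubgroup : Subgroup (absoluteGaloisGroup K))).obj
      (presentationComplex ρ).X₃)) (f : (presentationComplex ρ).X₁ ⟶ ideleBarD K)
    (b : cocycles₂ ((ideleData K).obj E))
    (hb : (H2π _) b = ((ideleData K).layerCohomologyIso E 2).hom ((groupCohomology.map (MonoidHom.id _)
        ((invariantsQuotFunctor ℤ (E.openNormalSubgroup : Subgroup (absoluteGaloisGroup K))).map f) 2).hom
        ((groupCohomology.δ (presentationComplex_map_invariantsQuotFunctor_shortExact ρ h) 1 2 rfl).hom ((H1π _) γ)))) :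
    (haveI := E.numberField; haveI := E.isGalois;
      twoCocycleClass (units w.Completion).toTopRep ((IdeleCohomology.archReadoutPair w (layerEmb E)).pull b)) =
      (haveI := moduleFinite_presModule₁ ρ
       cohomologyMap (toTopRepHom ((presModule₁ ρ).restrictField w.Completion) (units w.Completion)
          (equivariantMap ((presModule₁ ρ).restrictField w.Completion) (units w.Completion)
            (readoutInvariant (ideleProjection K (Sum.inl w)) (presentationComplex ρ).X₁ f))) 2
        (galoisCohomology.res (presModule₁ ρ) w.Completion 2 ((pres_isSES ρ).δ₁ (inflatedClass ρ h γ)))) := by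
  haveI := E.numberField
  haveI := E.isGalois
  haveI := moduleFinite_presModule₁ ρ
  exact twoCocycleClass_pull_eq_of_H2π_eq ρ h (Sum.inl w) (ideleProjection K (Sum.inl w))
    (IdeleCohomology.archReadoutPair w (layerEmb E)) (archReadoutPair_f_layerEmb w) (archReadoutPair_φ_layerEmb w) γ f b hb

end Infinite

/-! ## §3 (P0): the inflated class is unramified wherever the inertia groups lie in `U_E` -/

section Unramified

include h

/-- **The inflated class `x = [σ ↦ γ(σ̄)]` is unramified at every finite place `v` all of whose inertia groups lie in `U_E`**:
`loc_v x ∈ H¹_ur(K_v, M)` (the restriction of the cocycle to `Γ_{K_v^{nr}}` vanishes identically, since `Γ_{K_v^{nr}}` maps into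
`I_{𝔓_v} ≤ U_E` and `γ(1) = 0`). [cite: NeukirchANT1999, Ch. II §9 Prop. (9.6)][cite: SerreLocalFields1979, IV §4] -/
theorem localization_inflatedClass_mem_unramifiedSubgroup (v : HeightOneSpectrum (𝓞 K))
    (hv : ∀ 𝔓 ∈ v.primesAbove, 𝔓.inertia (absoluteGaloisGroup K) ≤ (E.openNormalSubgroup : Subgroup (absoluteGaloisGroup K)))
    (γ : cocycles₁ ((invariantsQuotFunctor ℤ (E.openNormalSubgroup : Subgroup (absoluteGaloisGroup K))).obj
      (presentationComplex ρ).X₃)) :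
    galoisCohomology.localization ρ (Sum.inr v) 1 (inflatedClass ρ h γ) ∈ unramifiedSubgroup (GaloisRep.toLocal v ρ) 1 := by
  refine (DiscreteGaloisModule.mem_unramifiedSubgroup_iff (GaloisRep.toLocal v ρ) 1 _).2 ?_
  -- the doubly restricted cocycle is identically zero
  change galoisCohomology.res (ρ.restrictField (v.adicCompletion K)) (IsNonarchimedeanLocalField.maxUnramified (v.adicCompletion K)) 1
    (galoisCohomology.res ρ (v.adicCompletion K) 1 (inflatedClass ρ h γ)) = 0
  rw [inflatedClass, galoisCohomology.res_oneCocycleClass, galoisCohomology.res_oneCocycleClass]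
  refine (congrArg (oneCocycleClass _) ?_).trans (oneCocycleClass_zero _)
  apply Subtype.ext
  apply ContinuousMap.ext
  intro τ
  rw [galoisCohomology.pullback_absGaloisRestrict_apply, galoisCohomology.pullback_absGaloisRestrict_apply,
    pushCocycle_liftCont_apply]
  -- `res (Γ_{K_v^{nr}}) ⊆ I_{𝔓_v} ≤ U_E`, so the class of the restricted element in `Γ_K ⧸ U_E` is `1`
  have hσ : absGaloisRestrict K (v.adicCompletion K)
      (absGaloisRestrict (v.adicCompletion K) (IsNonarchimedeanLocalField.maxUnramified (v.adicCompletion K)) τ) ∈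
      (E.openNormalSubgroup : Subgroup (absoluteGaloisGroup K)) := by
    refine hv _ (adicCompletionPrime_mem_primesAbove K v) ?_
    rw [inertia_adicCompletionPrime_eq_map_absInertia]
    refine Subgroup.mem_map_of_mem _ ?_
    rw [← galUnr_eq_absInertia]
    exact IsNonarchimedeanLocalField.absGaloisRestrict_mem_galUnr _ _
  have h1 : (QuotientGroup.mk (absGaloisRestrict K (v.adicCompletion K)
      (absGaloisRestrict (v.adicCompletion K) (IsNonarchimedeanLocalField.maxUnramified (v.adicCompletion K)) τ)) :
        absoluteGaloisGroup K ⧸ (E.openNormalSubgroup : Subgroup (absoluteGaloisGroup K))) = 1 :=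
    (QuotientGroup.eq_one_iff _).mpr hσ
  rw [h1, cocycles₁_map_one]
  rfl

/-- **(P0) off a finite set**: there is a finite set `T` of finite places off which the inflated classes of ALL layer
`1`-cocycles are unramified (Neukirch III (2.6): almost every place has its inertia groups inside the open `U_E`).
[cite: NeukirchANT1999, Ch. III Thm. (2.6), Ch. II §9 Prop. (9.6)] -/
theorem exists_finset_forall_localization_inflatedClass_mem :
    ∃ T : Finset (HeightOneSpectrum (𝓞 K)), ∀ v : HeightOneSpectrum (𝓞 K), v ∉ T →
      ∀ γ : cocycles₁ ((invariantsQuotFunctor ℤ (E.openNormalSubgroup : Subgroup (absoluteGaloisGroup K))).obj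
        (presentationComplex ρ).X₃),
        galoisCohomology.localization ρ (Sum.inr v) 1 (inflatedClass ρ h γ) ∈ unramifiedSubgroup (GaloisRep.toLocal v ρ) 1 := by
  have hev := EllipticCurves.eventually_forall_inertia_le (E.openNormalSubgroup : Subgroup (absoluteGaloisGroup K))
    E.openNormalSubgroup.isOpen
  rw [Filter.eventually_cofinite] at hev
  refine ⟨hev.toFinset, fun v hv γ => localization_inflatedClass_mem_unramifiedSubgroup ρ h v ?_ γ⟩
  by_contra hcon
  exact hv (hev.mem_toFinset.2 hcon)

end Unramified

end FreePresentation

end Literature.NumberTheory.GaloisRepresentations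

end
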